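import Summits.CriticalPhenomena.PercolationContinuityZ3.Theorems.PercNearOneGluingNoHeavyConstsLinearLowerTailConjecture
import HarnessLib

/-!
# The four-point splitting inequality (conjecture), the triple-split inequality (conjecture), and their
# first-order shadow: a Venn/Hamming inequality for graph cuts (kernel)

builds on p205010 (kernel theorem, internal audit signed; external expert review pending)

PAPER-2 track "percolation constants", part (ii), seat `prim-consts-1`, gen 6 (lane index
`run/shared/lean/prim/consts/CONSTANTS.md`, row A19, §4 N29–N31; memo `FROM-prim-consts-1-g6-TROPICAL-AND-FOUR-POINT.md`).
Support file for the crux `NoHeavyLowerTail` (stmt-CriticalPhenomena-4575; `--supports … --as helper`): two `Prop` definitions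
(OPEN statements, tagged `@[conjecture]`) and theorems; no sorries; standard axioms.  Nothing here claims the conjectures.

Context.  The three-halves conjecture (LT³⁄₂) `Consts.LinearLowerTailThreeHalves` is kernel for every instance with `|A| ≤ 6`
(gen 5).  From `|A| = 8` on (and already for the six-terminal statement "`o` + five points, all fifteen pairs `≤ s` ⇒
`μ(o loses ≥ 2) ≤ (3/2)s`", which holds in every computed instance) NO argument whose percolation input consists of pair budgets and
partition-level association inequalities (Harris, vdBHK Thms 1.3–1.5) can reach `3/2`: the "iid-coin splitting law" passes all of them
(memo g4 §6).  This file records the candidate SECOND INPUT found in gen 6 and proves its first-order (min-cut) shadow.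

* `Consts.FourPointSplit` — **CONJECTURE (ED)**: for bond percolation on any finite graph and any four vertices `a b c d`,
    `μ(ab|cd) · μ(ac|bd) · μ(ad|bc) ≤ μ(a|·) · μ(b|·) · μ(c|·) · μ(d|·)`,
  where `μ(ab|cd) = μ(a ↔ b, c ↔ d, a ↮ c)` (exactly two clusters among the four, in that pairing) and `μ(a|·) = μ(a ↮ b, a ↮ c, a ↮ d)`.
  Symmetric in the four points; degree 3 against degree 4, so it forces one of three pairwise-crossing balanced splits to be of
  second order — the quantitative form of "first-order cuts form a cactus" (below).  The iid-coin law violates it at every `s < 1`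
  (ratio `4/s`); equality holds on every weighted `K₄` up to the factor `∏ p_e`; census (kit j131556: all connected graphs on `≤ 6`
  vertices × 7 uniform weights and random palettes, then random and annealed weighted graphs on `≤ 8` vertices in all weight regimes,
  `1.7·10⁷` instances, exact partition DP): max ratio `0.99985 < 1`, attained near the `K₄` equality family (`p_e ≈ 0.999`); no violation
  (second seed j131769 and `n ≤ 9` j131557 still running at filing, interim maxima `< 1`).
  The variants with `μ(a ↮ bcd, bcd connected)` on the right, or with `μ({a,b} ↮ {c,d})` on the left, are FALSE (sparse `K₄`; star).
* `Consts.TripleSplit` — **CONJECTURE (TS)**: `μ(a|b|c)² ≤ μ(a ↮ b) · μ(a ↮ c) · μ(b ↮ c)` ("a three-way split is of order 3/2");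
  census max ratio `1` (attained only in degenerate instances), `≤ 0.65` whenever all pair separations are `≤ 0.8`.
* `Consts.cut` / `Consts.cut_venn_le` — **KERNEL**: for nonnegative edge weights and ANY three vertex sets `U₁ U₂ U₃`, the cuts of the
  four odd Venn cells `U₁∩U₂∩U₃`, `U₁∖(U₂∪U₃)`, `U₂∖(U₁∪U₃)`, `U₃∖(U₁∪U₂)` weigh at most `cut U₁ + cut U₂ + cut U₃` (edge by edge this is
  "the code `{111,100,010,001}` has minimum Hamming distance 2").  `Consts.cut_fourPoint`: hence for four vertices, the sum of the three
  minimum balanced-split cuts is at least the sum of the four minimum isolating cuts — the `ε → 0` limit of (ED) along `1 − p_e = ε^{c_e}`;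
  `Consts.cut_three_le`: three disjoint sets' cuts weigh at most twice their union (the `ε → 0` shadow of (TS)).
  CAUTION recorded for the record: the isolating-form analogue of (TS), `μ(a|b|c)² ≤ μ(a|bc-side)μ(b|·)μ(c|·)` with `μ(x|·) = μ(x ↮ both others)`,
  is an equality on every weighted triangle but FALSE in general (ratio 1.045 on 7-vertex hub-pool graphs); only the pair-separation form is conjectured.
* `Consts.block_stab_two` — the stabbing step of the first-order theorem (memo §1): for `M < 3d` every block of length `≥ d` in `[1, M]` contains
  `d` or `M + 1 − d` (kernel; `omega`); `Consts.tripod_count` — step (d): weight{X ∋ u or v} = ½(weight{X ∋ u} + weight{X ∋ v} +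
  weight{X ∋ exactly one}).  The first-order theorem itself (cactus skeleton ⇒ blocks ⇒ `3/2`) is analysis resting on the cited
  structure theorem for minimum cuts and is NOT claimed in the kernel.

Relaxation values (kit j131548/j131592/j131714, SLSQP multistart over the full partition law; numerics, not theorems):
`o`+4, `D ≥ 2`: budgets 7/4 · +vdBHK 3/2 · +ED 5/3 · +vdBHK+ED 3/2;  `o`+5, `D ≥ 2`: budgets 2 · +vdBHK 1.639 · +vdBHK+TS 1.639 ·
+vdBHK+ED(+TS): see the memo (job j131714).  First-order LP with the 4-point exclusion alone: 3/2 at (`o`+4, 2) and (`o`+6, 3),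
7/4 at (`o`+5, 2) (5-cycle of lost pairs, killed by vdBHK), 5/3 at (`o`+7, 3) (kit j131574).
References: J. van den Berg, O. Häggström, J. Kahn, Random Structures Algorithms 29 (2006) 417–435, Thm. 1.3; N. Gladkov,
arXiv:2408.08457 (2024), Thm. 1.1, Lemma 3.1, Thm. 4.3 (decision-tree hybrids — the intended proof technology); N. Gladkov, A. Zimin,
arXiv:2404.08873 (2024), §5; E. A. Dinits, A. V. Karzanov, M. V. Lomonosov (1976) and Y. Dinitz, A. Vainshtein, SIAM J. Comput. 30
(2000) 753–808 (cactus structure of minimum cuts); G. Grimmett, *Percolation* (1999), §2.2.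
-/

noncomputable section

namespace Summit.CriticalPhenomena.PercolationContinuityZ3.Theorems

open MeasureTheory Set Literature.Probability.LatticeModels Literature.Probability.Percolation
open scoped Classical

namespace Consts

/-- **CONJECTURE (ED) — the four-point splitting inequality.**  For every finite weighted graph (`Fin n`, weights `w`,
`μ = prodBernoulli w`) and vertices `a b c d`:
`μ(a↔b, c↔d, a↮c) · μ(a↔c, b↔d, a↮b) · μ(a↔d, b↔c, a↮b) ≤ μ(a↮b,a↮c,a↮d) · μ(b↮a,b↮c,b↮d) · μ(c↮a,c↮b,c↮d) · μ(d↮a,d↮b,d↮c)`.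
(No distinctness hypothesis is needed: if two of the points coincide the left side vanishes.)  OPEN (conjectured in this programme,
PAPER-2 consts track, seat prim-consts-1 gen 6, 2026-08-21; exact census of 1.7·10⁷ weighted graphs on ≤ 8 vertices (kit j131556):
max ratio 0.99985, no violation; equality on weighted `K₄` up to `∏ p_e`; its min-cut shadow is `Consts.cut_fourPoint`).  It is violated by the iid-coin splitting law (the witness of the association barrier),
so it is a genuinely new, non-association input toward (LT³⁄₂) `Consts.LinearLowerTailThreeHalves`.
builds on p205010 (kernel theorem, internal audit signed; external expert review pending).
[cite: Gladkov2024, Thm. 1.1 and Lemma 3.1 (the decision-tree hybrid technology expected to prove it)] [status: open] -/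
@[conjecture] def FourPointSplit : Prop :=
  ∀ (n : ℕ) (w : Sym2 (Fin n) → unitInterval) (a b c d : Fin n),
    (prodBernoulli w).real (openConn a b ∩ openConn c d ∩ (openConn a c)ᶜ) *
        (prodBernoulli w).real (openConn a c ∩ openConn b d ∩ (openConn a b)ᶜ) *
        (prodBernoulli w).real (openConn a d ∩ openConn b c ∩ (openConn a b)ᶜ) ≤
      (prodBernoulli w).real ((openConn a b)ᶜ ∩ (openConn a c)ᶜ ∩ (openConn a d)ᶜ) *
        (prodBernoulli w).real ((openConn b a)ᶜ ∩ (openConn b c)ᶜ ∩ (openConn b d)ᶜ) *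
        (prodBernoulli w).real ((openConn c a)ᶜ ∩ (openConn c b)ᶜ ∩ (openConn c d)ᶜ) *
        (prodBernoulli w).real ((openConn d a)ᶜ ∩ (openConn d b)ᶜ ∩ (openConn d c)ᶜ)

/-- **CONJECTURE (TS) — the triple-split inequality.**  For every finite weighted graph and vertices `a b c`:
`μ(a↮b, a↮c, b↮c)² ≤ μ(a↮b) · μ(a↮c) · μ(b↮c)` — a three-way split of three points costs, to leading order, at least three halves
of a pair separation.  OPEN (conjectured in this programme, seat prim-consts-1 gen 6, 2026-08-21; census: no violation, ratio 1 only in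
degenerate instances where one point is almost surely isolated, `≤ 0.65` when all pair separations are `≤ 0.8`).  In the partition-law
relaxation of (LT³⁄₂) it removes first-order mass on three-block atoms, which pair budgets and association allow.
builds on p205010 (kernel theorem, internal audit signed; external expert review pending).
[cite: Gladkov2024, Thm. 1.1 (the companion inequality for connections, P(abc)² ≤ 8 P(ab)P(ac)P(bc))] [status: open] -/
@[conjecture] def TripleSplit : Prop :=
  ∀ (n : ℕ) (w : Sym2 (Fin n) → unitInterval) (a b c : Fin n),
    (prodBernoulli w).real ((openConn a b)ᶜ ∩ (openConn a c)ᶜ ∩ (openConn b c)ᶜ) ^ 2 ≤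
      (prodBernoulli w).real (openConn a b)ᶜ * (prodBernoulli w).real (openConn a c)ᶜ *
        (prodBernoulli w).real (openConn b c)ᶜ

/-! ### The first-order shadow: a Venn/Hamming inequality for graph cuts -/

variable {V : Type*} [Fintype V] [DecidableEq V]

/-- The (doubly counted) weight of the edge cut of a vertex set `U` for edge weights `c`: the sum over ORDERED pairs `(u, v)` with
exactly one of `u, v` in `U` of `c s(u,v)` — every crossing edge is counted once in each orientation, which is immaterial for the
homogeneous inequalities below. [folklore] -/
def cut (c : Sym2 V → ℝ) (U : Finset V) : ℝ :=
  ∑ u, ∑ v, if (u ∈ U ↔ v ∉ U) then c s(u, v) else 0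

omit [Fintype V] in
/-- Edge by edge: the indicators "exactly one endpoint in the cell" of the four odd Venn cells of `U₁ U₂ U₃` sum to at most the
indicators for `U₁, U₂, U₃` themselves (the code `{111, 100, 010, 001}` has minimum distance 2). [folklore] -/
theorem cut_venn_pointwise (c : ℝ) (hc : 0 ≤ c) (U₁ U₂ U₃ : Finset V) (u v : V) :
    (if (u ∈ U₁ ∩ U₂ ∩ U₃ ↔ v ∉ U₁ ∩ U₂ ∩ U₃) then c else 0) +
        (if (u ∈ U₁ \ (U₂ ∪ U₃) ↔ v ∉ U₁ \ (U₂ ∪ U₃)) then c else 0) +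
        (if (u ∈ U₂ \ (U₁ ∪ U₃) ↔ v ∉ U₂ \ (U₁ ∪ U₃)) then c else 0) +
        (if (u ∈ U₃ \ (U₁ ∪ U₂) ↔ v ∉ U₃ \ (U₁ ∪ U₂)) then c else 0) ≤
      (if (u ∈ U₁ ↔ v ∉ U₁) then c else 0) + (if (u ∈ U₂ ↔ v ∉ U₂) then c else 0) +
        (if (u ∈ U₃ ↔ v ∉ U₃) then c else 0) := by
  simp only [Finset.mem_inter, Finset.mem_sdiff, Finset.mem_union]
  by_cases h1 : u ∈ U₁ <;> by_cases h2 : u ∈ U₂ <;> by_cases h3 : u ∈ U₃ <;>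
    by_cases k1 : v ∈ U₁ <;> by_cases k2 : v ∈ U₂ <;> by_cases k3 : v ∈ U₃ <;>
    simp [h1, h2, h3, k1, k2, k3] <;> linarith

/-- **KERNEL (Venn/Hamming cut inequality).**  For nonnegative edge weights and any three vertex sets, the cuts of the four odd Venn
cells weigh at most the three cuts: `cut(U₁∩U₂∩U₃) + cut(U₁∖(U₂∪U₃)) + cut(U₂∖(U₁∪U₃)) + cut(U₃∖(U₁∪U₂)) ≤ cut U₁ + cut U₂ + cut U₃`.
[folklore] -/
theorem cut_venn_le (c : Sym2 V → ℝ) (hc : ∀ e, 0 ≤ c e) (U₁ U₂ U₃ : Finset V) :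
    cut c (U₁ ∩ U₂ ∩ U₃) + cut c (U₁ \ (U₂ ∪ U₃)) + cut c (U₂ \ (U₁ ∪ U₃)) + cut c (U₃ \ (U₁ ∪ U₂)) ≤
      cut c U₁ + cut c U₂ + cut c U₃ := by
  unfold cut
  simp only [← Finset.sum_add_distrib]
  refine Finset.sum_le_sum fun u _ => Finset.sum_le_sum fun v _ => ?_
  exact cut_venn_pointwise (c s(u, v)) (hc _) U₁ U₂ U₃ u v

/-- **KERNEL (first-order shadow of (ED)).**  Let `a b c d` be vertices and `U₁ ∋ a, b`, `U₂ ∋ a, c`, `U₃ ∋ a, d` vertex sets with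
`c, d ∉ U₁`, `b, d ∉ U₂`, `b, c ∉ U₃` (sides of the three balanced splits containing `a`).  Then there are four vertex sets isolating
`a`, `b`, `c`, `d` respectively from the other three points whose cuts weigh in total at most `cut U₁ + cut U₂ + cut U₃`.  Consequently
the sum of the three minimum balanced-split cuts is at least the sum of the four minimum isolating cuts: the `ε → 0` limit of
`Consts.FourPointSplit` along weights `1 − p_e = ε^{c_e}`. [folklore] -/
theorem cut_fourPoint (c : Sym2 V → ℝ) (hc : ∀ e, 0 ≤ c e) {a b c' d : V} {U₁ U₂ U₃ : Finset V}
    (ha₁ : a ∈ U₁) (hb₁ : b ∈ U₁) (hc₁ : c' ∉ U₁) (hd₁ : d ∉ U₁)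
    (ha₂ : a ∈ U₂) (hc₂ : c' ∈ U₂) (hb₂ : b ∉ U₂) (hd₂ : d ∉ U₂)
    (ha₃ : a ∈ U₃) (hd₃ : d ∈ U₃) (hb₃ : b ∉ U₃) (hc₃ : c' ∉ U₃) :
    ∃ A B C D : Finset V,
      (a ∈ A ∧ b ∉ A ∧ c' ∉ A ∧ d ∉ A) ∧ (b ∈ B ∧ a ∉ B ∧ c' ∉ B ∧ d ∉ B) ∧
      (c' ∈ C ∧ a ∉ C ∧ b ∉ C ∧ d ∉ C) ∧ (d ∈ D ∧ a ∉ D ∧ b ∉ D ∧ c' ∉ D) ∧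
      cut c A + cut c B + cut c C + cut c D ≤ cut c U₁ + cut c U₂ + cut c U₃ := by
  refine ⟨U₁ ∩ U₂ ∩ U₃, U₁ \ (U₂ ∪ U₃), U₂ \ (U₁ ∪ U₃), U₃ \ (U₁ ∪ U₂), ?_, ?_, ?_, ?_, cut_venn_le c hc U₁ U₂ U₃⟩ <;>
    simp [*]

/-- **KERNEL (first-order shadow of (TS)).**  For pairwise disjoint vertex sets `Xa, Xb, Xc` (read: the clusters of three mutually separated
points) the three cuts weigh at most twice the weight of their union — an edge meets at most two of three disjoint sets.  With minimum cuts this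
reads `2·c(Γ) ≥ κ(a) + κ(b) + κ(c)` for every closed set `Γ` realising the three-way split: the `ε → 0` limit of `Consts.TripleSplit`. [folklore] -/
theorem cut_three_le (c : Sym2 V → ℝ) (hc : ∀ e, 0 ≤ c e) {Xa Xb Xc : Finset V}
    (hab : Disjoint Xa Xb) (hac : Disjoint Xa Xc) (hbc : Disjoint Xb Xc) :
    cut c Xa + cut c Xb + cut c Xc ≤
      2 * ∑ u, ∑ v, if ((u ∈ Xa ↔ v ∉ Xa) ∨ (u ∈ Xb ↔ v ∉ Xb) ∨ (u ∈ Xc ↔ v ∉ Xc)) then c s(u, v) else 0 := by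
  unfold cut
  rw [Finset.mul_sum, ← Finset.sum_add_distrib, ← Finset.sum_add_distrib]
  refine Finset.sum_le_sum fun u _ => ?_
  rw [Finset.mul_sum, ← Finset.sum_add_distrib, ← Finset.sum_add_distrib]
  refine Finset.sum_le_sum fun v _ => ?_
  have h0 := hc s(u, v)
  have dab : ∀ x, x ∈ Xa → x ∈ Xb → False := fun x h1 h2 => Finset.disjoint_left.1 hab h1 h2
  have dac : ∀ x, x ∈ Xa → x ∈ Xc → False := fun x h1 h2 => Finset.disjoint_left.1 hac h1 h2
  have dbc : ∀ x, x ∈ Xb → x ∈ Xc → False := fun x h1 h2 => Finset.disjoint_left.1 hbc h1 h2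
  by_cases h1 : u ∈ Xa <;> by_cases h2 : u ∈ Xb <;> by_cases h3 : u ∈ Xc <;>
    by_cases k1 : v ∈ Xa <;> by_cases k2 : v ∈ Xb <;> by_cases k3 : v ∈ Xc <;>
    first
      | exact (dab u h1 h2).elim | exact (dac u h1 h3).elim | exact (dbc u h2 h3).elim
      | exact (dab v k1 k2).elim | exact (dac v k1 k3).elim | exact (dbc v k2 k3).elim
      | (simp [h1, h2, h3, k1, k2, k3]; try linarith)

/-! ### The stabbing step of the first-order theorem -/

omit [Fintype V] [DecidableEq V] in
/-- **KERNEL (two points stab all long blocks).**  If `M < 3d`, every block `[i, j] ⊆ [1, M]` of length `≥ d` contains the position `d` or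
the position `M + 1 − d`.  This is step (c) of the first-order theorem of the memo (§1): in the depth-first order of the cactus skeleton of the
minimum terminal cuts every first-order lost set is such a block, so two relay points meet every first-order bad cut, and the tripod count
`½[n(o,u)+n(o,v)+n(u,v)]` bounds the first-order bad mass by `3/2` times the largest pair mass. [folklore] -/
theorem block_stab_two {M d i j : ℕ} (hM : M < 3 * d) (hi : 1 ≤ i) (hj : j ≤ M) (hlen : i + d ≤ j + 1) :
    (i ≤ d ∧ d ≤ j) ∨ (i ≤ M + 1 - d ∧ M + 1 - d ≤ j) := by
  omega

omit [Fintype V] in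
/-- **KERNEL (tripod count).**  Step (d) of the first-order theorem: for any weighted family of vertex sets (read: the minimum cuts, by their
`o`-free sides) and two points `u, v`, the weight of the members containing `u` or `v` is half of [weight of members containing `u`] + [containing
`v`] + [containing exactly one of `u, v`] — each bracket being a pair-separation count when `o` lies outside every member. [folklore] -/
theorem tripod_count {ι : Type*} (F : Finset ι) (side : ι → Finset V) (wt : ι → ℝ) (u v : V) :
    ∑ X ∈ F, (if (u ∈ side X ∨ v ∈ side X) then wt X else 0) =
      (1 / 2) * ((∑ X ∈ F, if u ∈ side X then wt X else 0) + (∑ X ∈ F, if v ∈ side X then wt X else 0) +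
        ∑ X ∈ F, if (u ∈ side X ↔ v ∉ side X) then wt X else 0) := by
  rw [← Finset.sum_add_distrib, ← Finset.sum_add_distrib, Finset.mul_sum]
  refine Finset.sum_congr rfl fun X _ => ?_
  by_cases hu : u ∈ side X <;> by_cases hv : v ∈ side X <;> simp [hu, hv] <;> ring

end Consts

end Summit.CriticalPhenomena.PercolationContinuityZ3.Theorems
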